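import Literature.MathematicalPhysics.QuantumLattice.StrongExpDecayLGT
import Literature.MathematicalPhysics.QuantumLattice.BalabanRGHaarIterates
import Literature.MathematicalPhysics.QuantumLattice.LatticeGaugeDLRGibbsProofs
import Literature.Probability.LatticeModels.GibbsSpecificationTiltedRatio
import HarnessLib

/-!
# Boundary influence under exponential decay of correlations (Chatterjee, CMP 385 (2021), §7)
# — the change-of-boundary-condition identity and Corollary 7.4 without paths in the gauge group

S. Chatterjee, *A probabilistic mechanism for quark confinement*, CMP **385** (2021) 1007–1039
[Chatterjee2021], §7 «Lattice gauge theory in a cube»: under Definition 2.3 (exponential decay of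
correlations under arbitrary boundary conditions; tree `StrongExpDecayZd d ρ β K₁ K₂`,
`StrongExpDecayLGT.lean`), the expectation of a local function `f` supported on an edge `e₁` of a cube
changes by at most `C₁ e^{−C₂ dist(e₁, e)}` when the boundary condition is changed at ONE boundary edge `e`
(**Corollary 7.4**, second claim: «if `δ_e` is replaced by any other value `δ_e'`, the value of `⟨f⟩`
changes by at most `C₁ r^{d−1} e^{−C₂ r}`»), and by at most `|A|` times that for a change on a set `A`
(**Lemma 7.5**). The printed proof differentiates `⟨f⟩` along a piecewise smooth path in `G`
(§4, Lemma 4.1 / Cor. 4.2, using that `G` is a connected Lie group) and integrates the covariance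
formula (7.2) `∇_e⟨f⟩ = −β⟨f ∇_e H_N⟩ + β⟨f⟩⟨∇_e H_N⟩`.

This file proves the same bounds for the tree's Wilson kernels `ymSpecification ρ β Λ η` by a
DERIVATIVE-FREE route, valid for EVERY compact gauge group (no connectedness, no Lie structure): the
finite form of (7.2) is the exact **change-of-boundary-condition identity**
`⟨F⟩_{η^{a←b}} = ⟨F · E_a⟩_η / ⟨E_a⟩_η`, `E_a(U) = exp(−β [S_Λ(U^{a←b}) − S_Λ(U)])`
(`integral_ymSpecification_update_eq`; both kernels are tilts of the same glued product Haar
measure, Mathlib `tilted_tilted`), whence `⟨F⟩_{η^{a←b}} − ⟨F⟩_η = Cov_η(F, E_a) / ⟨E_a⟩_η` with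
`e^{−c} ≤ E_a ≤ e^{c}`, `c = |β| · 2C_ρ · #{plaquettes ∋ a}` (`abs_integral_ymSpecification_update_sub_le`:
`|⟨F⟩' − ⟨F⟩| ≤ e^{2c} |Cov_η(F, Ẽ_a)|`, `Ẽ_a = e^{−c} E_a ∈ (0, 1]`), and `Ẽ_a` is a `[−1,1]`-valued
local function supported on the edge `a` (`isCylinder_boltzmannRatio`), so that Definition 2.3 bounds
the covariance: `abs_integral_update_sub_le_of_strongExpDecayZd` (Cor. 7.4) and, telescoping over a finite
set of boundary edges, `abs_integral_sub_le_of_strongExpDecayZd_of_eqOn` (Lemma 7.5, edge-local `f`).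

These are the boundary-influence inputs of the proof of Chatterjee's Theorem 2.4 (centre half:
`HasStrongExpDecayZd ⇒ CentreUnbroken`, tree named fact `chatterjee2021_areaLaw_of_strongExpDecay`); the
remaining printed steps are Lemma 7.3 (non-local `f`, by the Markov property) and the coupling
construction §§8–11. Not here: any statement about which theories satisfy Definition 2.3.

## References
* S. Chatterjee, CMP 385 (2021), arXiv:2006.16229: §2.4 Def. 2.3; §7 eq. (7.2), Lemma 7.1, Cor. 7.4,
  Lemma 7.5.
* H.-O. Georgii, *Gibbs Measures and Phase Transitions* (2011), proof of Prop. 8.8 (tilts of one measure).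
-/

noncomputable section

open MeasureTheory Filter Function
open scoped Topology

namespace Literature.MathematicalPhysics.QuantumLattice

open Literature.Probability.LatticeModels

/-! ### §1 The change-of-boundary-condition identity for the Wilson kernels -/

section Wilson

variable {d N : ℕ} {G : Type*} [Group G] [TopologicalSpace G] [IsTopologicalGroup G]
  [CompactSpace G] [MeasurableSpace G] [BorelSpace G] (ρ : G →* Matrix (Fin N) (Fin N) ℂ)

omit [CompactSpace G] [MeasurableSpace G] [BorelSpace G] in
/-- The Boltzmann ratio `E_{a,b}(U) = exp(−β [S_Λ(U^{a←b}) − S_Λ(U)])` of a one-link change of boundary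
condition is continuous, hence measurable, for a continuous representation. [folklore] -/
private theorem continuous_boltzmannRatio (hρ : Continuous ρ) (β : ℝ) (Λ : Finset (ZdEdge d))
    (a : ZdEdge d) (b : G) : Continuous fun U : LGConfig d G =>
      Real.exp (-β * (wilsonBoundaryAction ρ Λ (Function.update U a b) - wilsonBoundaryAction ρ Λ U)) := by
  refine Real.continuous_exp.comp (continuous_const.mul ?_)
  exact ((continuous_wilsonBoundaryAction ρ hρ Λ).comp
    ((continuous_id.update a continuous_const))).sub (continuous_wilsonBoundaryAction ρ hρ Λ)

omit [TopologicalSpace G] [IsTopologicalGroup G] [CompactSpace G] [MeasurableSpace G] [BorelSpace G] in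
/-- **The exponent of the Boltzmann ratio is bounded by `|β| · 2C · #{plaquettes through a}`**: only the
plaquettes through the changed link contribute to `S_Λ(U^{a←b}) − S_Λ(U)`, each by at most `2C` when
`|Re tr ρ(U_p)| ≤ C` (`abs_wilsonBoundaryAction_sub_le`). [folklore] -/
private theorem abs_exponent_le {C : ℝ} (hC0 : 0 ≤ C)
    (hC : ∀ (x : Site d) (i j : Fin d) (U : LGConfig d G), |plaquetteObs ρ x i j U| ≤ C)
    (β : ℝ) (Λ : Finset (ZdEdge d)) (a : ZdEdge d) (b : G) (U : LGConfig d G) :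
    |-β * (wilsonBoundaryAction ρ Λ (Function.update U a b) - wilsonBoundaryAction ρ Λ U)| ≤
      |β| * (2 * C * (plaquettesTouching ({a} : Finset (ZdEdge d))).card) := by
  rw [abs_mul, abs_neg]
  refine mul_le_mul_of_nonneg_left ?_ (abs_nonneg β)
  exact abs_wilsonBoundaryAction_sub_le ρ hC0 hC Λ {a} (U := Function.update U a b) (U' := U)
    fun e he => Function.update_of_ne (by simpa using he) _ _

/-- **Change-of-boundary-condition identity** (finite form of Chatterjee 2021 eq. (7.2)): for the Wilson
kernel of a finite link set `Λ`, an exterior link `a ∉ Λ`, a new value `b`, and a bounded measurable `F`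
that does not read the link `a`,
`∫ F dγ_Λ(· | η^{a←b}) = ∫ F E_{a,b} dγ_Λ(· | η) / ∫ E_{a,b} dγ_Λ(· | η)`.
Proof: both kernels are the glued product Haar measure tilted by `−β S_Λ ∘ glue`; gluing with
`η^{a←b}` is gluing with `η` followed by `U ↦ U^{a←b}` (`a ∉ Λ`), so the second exponent is the first plus
`log E_{a,b} ∘ glue_η`, and Mathlib's `tilted_tilted` / `integral_tilted` give the quotient.
[cite: Chatterjee2021, §7 eq. (7.2)] -/
theorem integral_ymSpecification_update_eq [SecondCountableTopology G] (hρ : Continuous ρ) (β : ℝ)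
    (Λ : Finset (ZdEdge d))
    (η : LGConfig d G) {a : ZdEdge d} (ha : a ∉ Λ) (b : G) {F : LGConfig d G → ℝ}
    (hFm : Measurable F) (hFa : ∀ U, F (Function.update U a b) = F U) :
    ∫ U, F U ∂(ymSpecification ρ β Λ (Function.update η a b)) =
      (∫ U, F U * Real.exp (-β * (wilsonBoundaryAction ρ Λ (Function.update U a b) -
          wilsonBoundaryAction ρ Λ U)) ∂(ymSpecification ρ β Λ η)) /
        ∫ U, Real.exp (-β * (wilsonBoundaryAction ρ Λ (Function.update U a b) -
          wilsonBoundaryAction ρ Λ U)) ∂(ymSpecification ρ β Λ η) := by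
  classical
  -- notation
  set π : Measure (↥Λ → G) := Measure.pi fun _ : ↥Λ => QuantumFieldTheory.haarProbability G with hπ
  set Φ : LGConfig d G → ℝ := fun U => -β * wilsonBoundaryAction ρ Λ U with hΦ
  set δ : LGConfig d G → ℝ := fun U =>
    -β * (wilsonBoundaryAction ρ Λ (Function.update U a b) - wilsonBoundaryAction ρ Λ U) with hδ
  have hΦm : Measurable Φ := (continuous_const.mul (continuous_wilsonBoundaryAction ρ hρ Λ)).measurable
  have hδc : Continuous δ := continuous_const.mul
    (((continuous_wilsonBoundaryAction ρ hρ Λ).comp (continuous_id.update a continuous_const)).sub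
      (continuous_wilsonBoundaryAction ρ hρ Λ))
  have hδm : Measurable δ := hδc.measurable
  -- gluing with `η^{a←b}` = gluing with `η`, then updating `a`
  have hglue : ∀ u : ↥Λ → G, glueWith Λ u (Function.update η a b) = Function.update (glueWith Λ u η) a b := by
    intro u
    funext x
    by_cases hx : x ∈ Λ
    · have hxa : x ≠ a := fun h => ha (h ▸ hx)
      rw [glueWith_apply_mem _ _ _ hx, Function.update_of_ne hxa, glueWith_apply_mem _ _ _ hx]
    · by_cases hxa : x = a
      · subst hxa
        rw [glueWith_apply_not_mem _ _ _ hx, Function.update_self, Function.update_self]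
      · rw [glueWith_apply_not_mem _ _ _ hx, Function.update_of_ne hxa, Function.update_of_ne hxa,
          glueWith_apply_not_mem _ _ _ hx]
  -- the two pulled-back exponents differ by `δ ∘ glue_η`
  have hexp : (Φ ∘ fun u : ↥Λ → G => glueWith Λ u (Function.update η a b)) =
      (Φ ∘ fun u : ↥Λ → G => glueWith Λ u η) + (δ ∘ fun u : ↥Λ → G => glueWith Λ u η) := by
    funext u
    simp only [Function.comp_apply, Pi.add_apply, hΦ, hδ, hglue u]
    ring
  -- integrability of the first Boltzmann factor on `π`
  have hbdd : ∃ B, ∀ U : LGConfig d G, |Φ U| ≤ B := exists_bound_of_continuous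
    (continuous_const.mul (continuous_wilsonBoundaryAction ρ hρ Λ))
  have hint : Integrable (fun u : ↥Λ → G => Real.exp ((Φ ∘ fun u => glueWith Λ u η) u)) π := by
    obtain ⟨B, hB⟩ := hbdd
    exact integrable_exp_of_abs_le π (hΦm.comp (measurable_glueWith Λ η)) ⟨B, fun u => hB _⟩
  -- unfold the two kernels as tilts of `π`
  have hL : ∫ U, F U ∂(ymSpecification ρ β Λ (Function.update η a b)) =
      ∫ u, F (glueWith Λ u (Function.update η a b))
        ∂(π.tilted (Φ ∘ fun u => glueWith Λ u (Function.update η a b))) :=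
    integral_tilted_map_eq_integral_tilted_comp π (measurable_glueWith Λ _) hΦm hFm
  have hR : ∀ {H : LGConfig d G → ℝ}, Measurable H →
      ∫ U, H U ∂(ymSpecification ρ β Λ η) = ∫ u, H (glueWith Λ u η) ∂(π.tilted (Φ ∘ fun u => glueWith Λ u η)) :=
    fun hH => integral_tilted_map_eq_integral_tilted_comp π (measurable_glueWith Λ _) hΦm hH
  have hEm : Measurable fun U : LGConfig d G => Real.exp (δ U) :=
    (continuous_boltzmannRatio ρ hρ β Λ a b).measurable
  rw [show (fun U : LGConfig d G => Real.exp (-β * (wilsonBoundaryAction ρ Λ (Function.update U a b) -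
      wilsonBoundaryAction ρ Λ U))) = fun U => Real.exp (δ U) from rfl] at hEm ⊢
  rw [hL, hR (H := fun U => F U * Real.exp (δ U)) (hFm.mul hEm), hR hEm, hexp,
    ← tilted_tilted hint, integral_tilted]
  simp only [Function.comp_apply, hglue, hFa, smul_eq_mul]
  rw [← integral_div]
  refine integral_congr_ae (ae_of_all _ fun u => ?_)
  ring

/-- **Boundary influence ≤ `e^{2c}` × covariance** (Chatterjee 2021, Cor. 7.4, the step «combining the
covariance formula with the bound on `∇_e H_N`», derivative-free): for `|Re tr ρ(U_p)| ≤ C`, `a ∉ Λ`,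
`c = |β| · 2C · #{plaquettes ∋ a}`, a measurable `F` with `|F| ≤ 1` not reading the link `a`, and the
normalised ratio `Ẽ = e^{−c} E_{a,b} ∈ [e^{−2c}, 1]`:
`|∫ F dγ_Λ(·|η^{a←b}) − ∫ F dγ_Λ(·|η)| ≤ e^{2c} |∫ F Ẽ dγ_Λ(·|η) − (∫ F dγ_Λ(·|η))(∫ Ẽ dγ_Λ(·|η))|`.
[cite: Chatterjee2021, Cor. 7.4] -/
theorem abs_integral_ymSpecification_update_sub_le [SecondCountableTopology G]
    (hρ : Continuous ρ) {C : ℝ} (hC0 : 0 ≤ C)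
    (hC : ∀ (x : Site d) (i j : Fin d) (U : LGConfig d G), |plaquetteObs ρ x i j U| ≤ C)
    (β : ℝ) (Λ : Finset (ZdEdge d)) (η : LGConfig d G) {a : ZdEdge d} (ha : a ∉ Λ) (b : G)
    {F : LGConfig d G → ℝ} (hFm : Measurable F) (hF1 : ∀ U, |F U| ≤ 1)
    (hFa : ∀ U, F (Function.update U a b) = F U) :
    |(∫ U, F U ∂(ymSpecification ρ β Λ (Function.update η a b))) - ∫ U, F U ∂(ymSpecification ρ β Λ η)| ≤
      Real.exp (2 * (|β| * (2 * C * (plaquettesTouching ({a} : Finset (ZdEdge d))).card))) *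
        |(∫ U, F U * (Real.exp (-(|β| * (2 * C * (plaquettesTouching ({a} : Finset (ZdEdge d))).card))) *
              Real.exp (-β * (wilsonBoundaryAction ρ Λ (Function.update U a b) - wilsonBoundaryAction ρ Λ U)))
            ∂(ymSpecification ρ β Λ η)) -
          (∫ U, F U ∂(ymSpecification ρ β Λ η)) *
            ∫ U, Real.exp (-(|β| * (2 * C * (plaquettesTouching ({a} : Finset (ZdEdge d))).card))) *
              Real.exp (-β * (wilsonBoundaryAction ρ Λ (Function.update U a b) - wilsonBoundaryAction ρ Λ U))
            ∂(ymSpecification ρ β Λ η)| := by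
  set c : ℝ := |β| * (2 * C * (plaquettesTouching ({a} : Finset (ZdEdge d))).card) with hc
  set μ := ymSpecification ρ β Λ η with hμ
  haveI : IsProbabilityMeasure μ := isProbabilityMeasure_ymSpecification ρ hρ β Λ η
  set E : LGConfig d G → ℝ := fun U =>
    Real.exp (-β * (wilsonBoundaryAction ρ Λ (Function.update U a b) - wilsonBoundaryAction ρ Λ U)) with hEdef
  have hEm : Measurable E := (continuous_boltzmannRatio ρ hρ β Λ a b).measurable
  have hEpos : ∀ U, 0 < E U := fun U => Real.exp_pos _
  -- `e^{−c} ≤ E ≤ e^{c}`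
  have hElo : ∀ U, Real.exp (-c) ≤ E U := fun U => by
    rw [hEdef, Real.exp_le_exp]
    exact (abs_le.1 (abs_exponent_le ρ hC0 hC β Λ a b U)).1
  have hEhi : ∀ U, E U ≤ Real.exp c := fun U => by
    rw [hEdef, Real.exp_le_exp]
    exact (abs_le.1 (abs_exponent_le ρ hC0 hC β Λ a b U)).2
  -- integrability
  have hEi : Integrable E μ := Integrable.of_bound hEm.aestronglyMeasurable (Real.exp c)
    (ae_of_all _ fun U => by
      rw [Real.norm_eq_abs, abs_of_pos (hEpos U)]; exact hEhi U)
  have hFEi : Integrable (fun U => F U * E U) μ := by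
    refine Integrable.of_bound (hFm.mul hEm).aestronglyMeasurable (1 * Real.exp c)
      (ae_of_all _ fun U => ?_)
    rw [Real.norm_eq_abs, abs_mul, abs_of_pos (hEpos U)]
    exact mul_le_mul (hF1 U) (hEhi U) (hEpos U).le zero_le_one
  have hZpos : 0 < ∫ U, E U ∂μ := by
    calc (0 : ℝ) < Real.exp (-c) := Real.exp_pos _
      _ = ∫ _U, Real.exp (-c) ∂μ := by simp
      _ ≤ ∫ U, E U ∂μ := integral_mono (integrable_const _) hEi hElo
  have hZlo : Real.exp (-c) ≤ ∫ U, E U ∂μ := by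
    calc Real.exp (-c) = ∫ _U, Real.exp (-c) ∂μ := by simp
      _ ≤ ∫ U, E U ∂μ := integral_mono (integrable_const _) hEi hElo
  -- the identity and the covariance form
  have hid : ∫ U, F U ∂(ymSpecification ρ β Λ (Function.update η a b)) =
      (∫ U, F U * E U ∂μ) / ∫ U, E U ∂μ :=
    integral_ymSpecification_update_eq ρ hρ β Λ η ha b hFm hFa
  have hcov : (∫ U, F U ∂(ymSpecification ρ β Λ (Function.update η a b))) - ∫ U, F U ∂μ =
      ((∫ U, F U * E U ∂μ) - (∫ U, F U ∂μ) * ∫ U, E U ∂μ) / ∫ U, E U ∂μ := by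
    rw [hid]
    field_simp
  -- normalised ratio
  have hnum : (∫ U, F U * (Real.exp (-c) * E U) ∂μ) - (∫ U, F U ∂μ) * ∫ U, Real.exp (-c) * E U ∂μ =
      Real.exp (-c) * ((∫ U, F U * E U ∂μ) - (∫ U, F U ∂μ) * ∫ U, E U ∂μ) := by
    have h1 : ∫ U, F U * (Real.exp (-c) * E U) ∂μ = Real.exp (-c) * ∫ U, F U * E U ∂μ := by
      rw [← integral_const_mul]
      refine integral_congr_ae (ae_of_all _ fun U => ?_)
      ring
    rw [h1, integral_const_mul]
    ring
  rw [hcov, hnum, abs_div, abs_of_pos hZpos, abs_mul, abs_of_pos (Real.exp_pos _)]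
  -- `|X| / Z ≤ e^{2c} e^{-c} |X|` since `Z ≥ e^{-c}`
  set X := (∫ U, F U * E U ∂μ) - (∫ U, F U ∂μ) * ∫ U, E U ∂μ with hX
  rw [div_le_iff₀ hZpos]
  have hX0 : 0 ≤ |X| := abs_nonneg _
  calc |X| = Real.exp (2 * c) * (Real.exp (-c) * |X|) * Real.exp (-c) := by
        rw [show Real.exp (2 * c) * (Real.exp (-c) * |X|) * Real.exp (-c) =
          (Real.exp (2 * c) * Real.exp (-c) * Real.exp (-c)) * |X| by ring, ← Real.exp_add, ← Real.exp_add,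
          show 2 * c + -c + -c = 0 by ring, Real.exp_zero, one_mul]
    _ ≤ Real.exp (2 * c) * (Real.exp (-c) * |X|) * ∫ U, E U ∂μ :=
        mul_le_mul_of_nonneg_left hZlo (by positivity)

/-! ### §2 The Boltzmann ratio is a local function supported on the changed link -/

omit [TopologicalSpace G] [IsTopologicalGroup G] [CompactSpace G] [MeasurableSpace G] [BorelSpace G] in
/-- **Locality of the Boltzmann ratio**: `E_{a,b}` (and any rescaling of it) depends on `U` only through
the links of the plaquettes through `a` — «`∇_e H_N` is a local function supported on `e`» (Chatterjee
2021, §7, sentence before (7.2)): plaquettes not containing `a` cancel in `S_Λ(U^{a←b}) − S_Λ(U)`.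
[cite: Chatterjee2021, §7 (∇_e H_N is a local function supported on e)] -/
theorem isCylinder_boltzmannRatio (β : ℝ) (Λ : Finset (ZdEdge d)) (a : ZdEdge d) (b : G) (t : ℝ) :
    IsCylinder (fun U : LGConfig d G => t * Real.exp (-β * (wilsonBoundaryAction ρ Λ (Function.update U a b) -
        wilsonBoundaryAction ρ Λ U)))
      ((plaquettesTouching ({a} : Finset (ZdEdge d))).biUnion plaquetteEdges) := by
  classical
  intro U V hUV
  -- termwise equality of the action differences
  have hterm : ∀ p ∈ plaquettesTouching Λ,
      plaquetteObs ρ p.1 p.2.1.1 p.2.1.2 (Function.update U a b) - plaquetteObs ρ p.1 p.2.1.1 p.2.1.2 U =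
        plaquetteObs ρ p.1 p.2.1.1 p.2.1.2 (Function.update V a b) -
          plaquetteObs ρ p.1 p.2.1.1 p.2.1.2 V := by
    intro p _
    by_cases hpa : a ∈ plaquetteEdges p
    · -- a plaquette through `a`: all its links lie in the support
      have hsub : ∀ e ∈ plaquetteEdges p, e ∈ (plaquettesTouching ({a} : Finset (ZdEdge d))).biUnion
          plaquetteEdges := fun e he =>
        Finset.mem_biUnion.2 ⟨p, mem_plaquettesTouching_iff.2 ⟨a, Finset.mem_inter.2 ⟨hpa, by simp⟩⟩, he⟩
      have h1 : plaquetteObs ρ p.1 p.2.1.1 p.2.1.2 U = plaquetteObs ρ p.1 p.2.1.1 p.2.1.2 V :=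
        isCylinder_plaquetteObs ρ p fun e he => hUV e (Finset.mem_coe.2 (hsub e (Finset.mem_coe.1 he)))
      have h2 : plaquetteObs ρ p.1 p.2.1.1 p.2.1.2 (Function.update U a b) =
          plaquetteObs ρ p.1 p.2.1.1 p.2.1.2 (Function.update V a b) :=
        isCylinder_plaquetteObs ρ p fun e he => by
          by_cases hea : e = a
          · subst hea; simp
          · rw [Function.update_of_ne hea, Function.update_of_ne hea]
            exact hUV e (Finset.mem_coe.2 (hsub e (Finset.mem_coe.1 he)))
      rw [h1, h2]
    · -- a plaquette avoiding `a`: the update is invisible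
      have hU : plaquetteObs ρ p.1 p.2.1.1 p.2.1.2 (Function.update U a b) =
          plaquetteObs ρ p.1 p.2.1.1 p.2.1.2 U :=
        isCylinder_plaquetteObs ρ p fun e he =>
          Function.update_of_ne (ne_of_mem_of_not_mem (Finset.mem_coe.1 he) hpa) _ _
      have hV : plaquetteObs ρ p.1 p.2.1.1 p.2.1.2 (Function.update V a b) =
          plaquetteObs ρ p.1 p.2.1.1 p.2.1.2 V :=
        isCylinder_plaquetteObs ρ p fun e he =>
          Function.update_of_ne (ne_of_mem_of_not_mem (Finset.mem_coe.1 he) hpa) _ _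
      rw [hU, hV, sub_self, sub_self]
  have hdiff : wilsonBoundaryAction ρ Λ (Function.update U a b) - wilsonBoundaryAction ρ Λ U =
      wilsonBoundaryAction ρ Λ (Function.update V a b) - wilsonBoundaryAction ρ Λ V := by
    unfold wilsonBoundaryAction
    rw [← Finset.sum_sub_distrib, ← Finset.sum_sub_distrib]
    refine Finset.sum_congr rfl fun p hp => ?_
    have := hterm p hp
    linarith
  show t * Real.exp (-β * (wilsonBoundaryAction ρ Λ (Function.update U a b) - wilsonBoundaryAction ρ Λ U)) =
    t * Real.exp (-β * (wilsonBoundaryAction ρ Λ (Function.update V a b) - wilsonBoundaryAction ρ Λ V))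
  rw [hdiff]

/-! ### §3 Corollary 7.4 and Lemma 7.5 under Definition 2.3 -/

/-- ★ **Chatterjee 2021, Corollary 7.4 (second claim), derivative-free**: under exponential decay of
correlations with constants `K₁, K₂` (Def. 2.3, `StrongExpDecayZd d ρ β K₁ K₂`) and `|Re tr ρ(U_p)| ≤ C`,
for a cube `v + {0,…,M}^d` with interior link set `Λ`, a boundary condition `η`, an edge `e₂` of the cube
outside `Λ` and outside the plaquette-neighbourhood of the edge `e₁`, and a measurable `f` with `|f| ≤ 1`
supported on the plaquette-neighbourhood of `e₁`: replacing `η_{e₂}` by any other value changes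
`∫ f dγ_Λ(·|η)` by at most `e^{2c} K₁ e^{−K₂ dist(e₁,e₂)}`, `c = |β|·2C·#{plaquettes ∋ e₂}` — for EVERY
compact gauge group (the printed proof uses paths in a connected Lie group `G`). [cite: Chatterjee2021, Cor. 7.4] -/
theorem abs_integral_update_sub_le_of_strongExpDecayZd [SecondCountableTopology G]
    (hρ : Continuous ρ) {C : ℝ} (hC0 : 0 ≤ C)
    (hC : ∀ (x : Site d) (i j : Fin d) (U : LGConfig d G), |plaquetteObs ρ x i j U| ≤ C)
    {β K₁ K₂ : ℝ} (hdecay : StrongExpDecayZd d ρ β K₁ K₂) (M : ℕ) (v : Fin d → ℤ)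
    (Λ : Finset (ZdEdge d))
    (hΛ : Λ = (((Fintype.piFinset fun j : Fin d => Finset.Icc (v j) (v j + M)) ×ˢ
        (Finset.univ : Finset (Fin d))).filter fun e =>
          e.1 e.2 + 1 ≤ v e.2 + M ∧ ∀ j, j ≠ e.2 → v j < e.1 j ∧ e.1 j < v j + M))
    (η : LGConfig d G) (e₁ e₂ : ZdEdge d)
    (he₁ : ∀ j, v j ≤ e₁.1 j ∧ e₁.1 j ≤ v j + M) (he₁' : e₁.1 e₁.2 + 1 ≤ v e₁.2 + M)
    (he₂ : ∀ j, v j ≤ e₂.1 j ∧ e₂.1 j ≤ v j + M) (he₂' : e₂.1 e₂.2 + 1 ≤ v e₂.2 + M)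
    (he₂Λ : e₂ ∉ Λ) (he₁₂ : e₂ ∉ (plaquettesTouching ({e₁} : Finset (ZdEdge d))).biUnion plaquetteEdges)
    (b : G) {f : LGConfig d G → ℝ} (hfm : Measurable f)
    (hfcyl : IsCylinder f ((plaquettesTouching ({e₁} : Finset (ZdEdge d))).biUnion plaquetteEdges))
    (hf1 : ∀ U, |f U| ≤ 1) :
    |(∫ U, f U ∂(ymSpecification ρ β Λ (Function.update η e₂ b))) - ∫ U, f U ∂(ymSpecification ρ β Λ η)| ≤
      Real.exp (2 * (|β| * (2 * C * (plaquettesTouching ({e₂} : Finset (ZdEdge d))).card))) *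
        (K₁ * Real.exp (-(K₂ * QuantumFieldTheory.setDistEdges {e₁} {e₂}))) := by
  set c : ℝ := |β| * (2 * C * (plaquettesTouching ({e₂} : Finset (ZdEdge d))).card) with hc
  -- `f` does not read `e₂`
  have hfa : ∀ U, f (Function.update U e₂ b) = f U := fun U =>
    hfcyl fun e he => Function.update_of_ne (ne_of_mem_of_not_mem (Finset.mem_coe.1 he) he₁₂) _ _
  have h1 := abs_integral_ymSpecification_update_sub_le ρ hρ hC0 hC β Λ η he₂Λ b hfm hf1 hfa
  refine h1.trans (mul_le_mul_of_nonneg_left ?_ (Real.exp_pos _).le)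
  -- Definition 2.3 applied to `f` and the normalised Boltzmann ratio
  set g : LGConfig d G → ℝ := fun U => Real.exp (-c) *
    Real.exp (-β * (wilsonBoundaryAction ρ Λ (Function.update U e₂ b) - wilsonBoundaryAction ρ Λ U)) with hg
  have hgm : Measurable g := measurable_const.mul (continuous_boltzmannRatio ρ hρ β Λ e₂ b).measurable
  have hgcyl : IsCylinder g ((plaquettesTouching ({e₂} : Finset (ZdEdge d))).biUnion plaquetteEdges) :=
    isCylinder_boltzmannRatio ρ β Λ e₂ b (Real.exp (-c))
  have hg1 : ∀ U, |g U| ≤ 1 := fun U => by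
    have hpos : 0 < Real.exp (-β * (wilsonBoundaryAction ρ Λ (Function.update U e₂ b) -
        wilsonBoundaryAction ρ Λ U)) := Real.exp_pos _
    have hhi : Real.exp (-β * (wilsonBoundaryAction ρ Λ (Function.update U e₂ b) -
        wilsonBoundaryAction ρ Λ U)) ≤ Real.exp c := by
      rw [Real.exp_le_exp]
      exact (abs_le.1 (abs_exponent_le ρ hC0 hC β Λ e₂ b U)).2
    rw [hg, abs_of_pos (mul_pos (Real.exp_pos _) hpos)]
    calc Real.exp (-c) * Real.exp (-β * (wilsonBoundaryAction ρ Λ (Function.update U e₂ b) -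
          wilsonBoundaryAction ρ Λ U)) ≤ Real.exp (-c) * Real.exp c :=
          mul_le_mul_of_nonneg_left hhi (Real.exp_pos _).le
      _ = 1 := by rw [← Real.exp_add]; simp
  exact hdecay M v Λ η e₁ e₂ f g hΛ he₁ he₁' he₂ he₂' hfm hgm hfcyl hgcyl hf1 hg1

/-- ★ **Chatterjee 2021, Lemma 7.5 for an edge-local observable**, derivative-free: under the hypotheses of
`abs_integral_update_sub_le_of_strongExpDecayZd`, two boundary conditions `η, η'` that agree off a finite
set `A` of edges of the cube, all outside `Λ` and outside the plaquette-neighbourhood of `e₁`, give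
expectations of `f` differing by at most `Σ_{a ∈ A} e^{2c_a} K₁ e^{−K₂ dist(e₁, a)}` (change the links of
`A` one at a time). [cite: Chatterjee2021, Lemma 7.5] -/
theorem abs_integral_sub_le_of_strongExpDecayZd_of_eqOn [SecondCountableTopology G]
    (hρ : Continuous ρ) {C : ℝ} (hC0 : 0 ≤ C)
    (hC : ∀ (x : Site d) (i j : Fin d) (U : LGConfig d G), |plaquetteObs ρ x i j U| ≤ C)
    {β K₁ K₂ : ℝ} (hdecay : StrongExpDecayZd d ρ β K₁ K₂) (M : ℕ) (v : Fin d → ℤ)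
    (Λ : Finset (ZdEdge d))
    (hΛ : Λ = (((Fintype.piFinset fun j : Fin d => Finset.Icc (v j) (v j + M)) ×ˢ
        (Finset.univ : Finset (Fin d))).filter fun e =>
          e.1 e.2 + 1 ≤ v e.2 + M ∧ ∀ j, j ≠ e.2 → v j < e.1 j ∧ e.1 j < v j + M))
    (e₁ : ZdEdge d) (he₁ : ∀ j, v j ≤ e₁.1 j ∧ e₁.1 j ≤ v j + M) (he₁' : e₁.1 e₁.2 + 1 ≤ v e₁.2 + M)
    (A : Finset (ZdEdge d))
    (hA : ∀ a ∈ A, (∀ j, v j ≤ a.1 j ∧ a.1 j ≤ v j + M) ∧ a.1 a.2 + 1 ≤ v a.2 + M ∧ a ∉ Λ ∧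
      a ∉ (plaquettesTouching ({e₁} : Finset (ZdEdge d))).biUnion plaquetteEdges)
    (η η' : LGConfig d G) (hηη' : ∀ e, e ∉ A → η e = η' e)
    {f : LGConfig d G → ℝ} (hfm : Measurable f)
    (hfcyl : IsCylinder f ((plaquettesTouching ({e₁} : Finset (ZdEdge d))).biUnion plaquetteEdges))
    (hf1 : ∀ U, |f U| ≤ 1) :
    |(∫ U, f U ∂(ymSpecification ρ β Λ η')) - ∫ U, f U ∂(ymSpecification ρ β Λ η)| ≤
      ∑ a ∈ A, Real.exp (2 * (|β| * (2 * C * (plaquettesTouching ({a} : Finset (ZdEdge d))).card))) *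
        (K₁ * Real.exp (-(K₂ * QuantumFieldTheory.setDistEdges {e₁} {a}))) := by
  classical
  -- interpolate: `ζ s` = `η'` on `s`, `η` elsewhere
  have key : ∀ s : Finset (ZdEdge d), s ⊆ A →
      |(∫ U, f U ∂(ymSpecification ρ β Λ (s.piecewise η' η))) - ∫ U, f U ∂(ymSpecification ρ β Λ η)| ≤
        ∑ a ∈ s, Real.exp (2 * (|β| * (2 * C * (plaquettesTouching ({a} : Finset (ZdEdge d))).card))) *
          (K₁ * Real.exp (-(K₂ * QuantumFieldTheory.setDistEdges {e₁} {a}))) := by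
    intro s
    induction s using Finset.induction_on with
    | empty =>
      intro _
      simp
    | insert a s has ih =>
      intro hs
      have haA : a ∈ A := hs (Finset.mem_insert_self a s)
      have hsA : s ⊆ A := fun x hx => hs (Finset.mem_insert_of_mem hx)
      obtain ⟨ha1, ha2, haΛ, ha12⟩ := hA a haA
      rw [Finset.sum_insert has, Finset.piecewise_insert]
      have hstep := abs_integral_update_sub_le_of_strongExpDecayZd ρ hρ hC0 hC hdecay M v Λ hΛ
        (s.piecewise η' η) e₁ a he₁ he₁' ha1 ha2 haΛ ha12 (η' a) hfm hfcyl hf1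
      have hprev := ih hsA
      calc |(∫ U, f U ∂(ymSpecification ρ β Λ (Function.update (s.piecewise η' η) a (η' a)))) -
              ∫ U, f U ∂(ymSpecification ρ β Λ η)|
          ≤ |(∫ U, f U ∂(ymSpecification ρ β Λ (Function.update (s.piecewise η' η) a (η' a)))) -
                ∫ U, f U ∂(ymSpecification ρ β Λ (s.piecewise η' η))| +
              |(∫ U, f U ∂(ymSpecification ρ β Λ (s.piecewise η' η))) -
                ∫ U, f U ∂(ymSpecification ρ β Λ η)| := abs_sub_le _ _ _
        _ ≤ _ := add_le_add hstep hprev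
  have hpw : A.piecewise η' η = η' := by
    funext e
    by_cases he : e ∈ A
    · rw [Finset.piecewise_eq_of_mem _ _ _ he]
    · rw [Finset.piecewise_eq_of_notMem _ _ _ he, hηη' e he]
  have := key A le_rfl
  rwa [hpw] at this

end Wilson

end Literature.MathematicalPhysics.QuantumLattice

end
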